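import Literature.IUT.HodgeTheaters.GlobalFrobenioidsCyclotomes
import Literature.IUT.HodgeTheaters.GlobalFrobenioidsCyclotomeRigidityZHat
import HarnessLib

/-!
# [IUTchI] Example 5.1 (v), p. 128, SECOND display (`†𝕄^⊛`): the unique isomorphism of cyclotomes from a
# `Ẑ^×`-LINEAR VALUATION on the Kummer container (structural form of the `𝒪^⊿_𝔭`-compatibility argument)

S. Mochizuki, *Inter-universal Teichmüller theory I*, kurims manuscript (May 2020), §5, Example 5.1 (v)
p. 128 l. 25–49 [claim: Mochizuki2012, status: disputed]: "there exists a unique isomorphism of cyclotomes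
`μ^Θ_Ẑ(π₁(†𝒟^⊚)) ⥲ μ_Ẑ(†𝕄^⊛)` such that the resulting isomorphism between direct limits of cohomology
modules induces isomorphisms `𝕄^⊛(†𝒟^⊚) ⥲ †𝕄^⊛`, … in a fashion that is compatible with the integral
submonoids "`𝒪^⊿_𝔭`""; (iv) p. 126 l. 35–38: `𝒪^⊿_𝔭` is "the submonoid of integral elements of `𝒪^×(A^birat)`
with respect to the valuation determined by `𝔭`".

Cell abc-iut, sub-DAG `plan/L5/SUBDAG-IUTchI-Ex51.md` row E51/L28; GAP-LEDGER row G-w4d057g4-1 (the interface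
laws at the genuine `†𝕄^⊛` Kummer data).  Companion of abc-iut-w4-d057's
`GlobalFrobenioidsCyclotomeIsoOfIntegralLaws.lean` (`UniqueCyclotomeIsoFamily.of_integral_laws`, laws
(E)(T)(V)(I)(P) with an integer-valued `val` read on one layer).  Here the two laws (V) "valuation transport"
and (I) "integrality" are replaced by ONE STRUCTURAL DATUM that the genuine container carries: for each prime
`𝔭` a `Ẑ`-valued map `V_𝔭` on the container [the continuous extension `v̂_𝔭 : lim_H H¹(H, μ_Ẑ) ⊇ K̂^× → Ẑ` of the
`𝔭`-adic valuation] which is `Ẑ^×`-LINEAR on the layer (`V_𝔭 (twist u h) = u (V_𝔭 h)` — `u ∈ Ẑ^× = Aut(Ẑ)` acts on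
the coefficients) and takes values in `η(ℤ_{≥0})` on the classes of the integral submonoid `𝒪^⊿_𝔭` [integral
elements have non-negative INTEGER valuation].  This is the valuation analogue of GAP row G-w4d056-2 (b′)
(divisor map at points ↦ valuation map at primes), in the shape of the L2 Kummer-container lane
(abc-iut-w4-d056's `H1Colimit` with its `Ẑ^×`-module structure `zhatMulAction`, p427838).

## What is proved (theorems only; explicit hypotheses, no definition, no new fact)

* `UniqueCyclotomeIsoFamily.of_valuation` — **E51/L28** from (E) existence of an isomorphism satisfying the
  whole such-that clause `InducesCompatibleIsos`, (T) torsor + functoriality, (L) a `Ẑ^×`-linear `V_𝔭` on one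
  layer `i₀` with (I′) `V_𝔭(κ(𝒪^⊿_𝔭)) ⊆ η(ℤ_{≥0})` and (P′) one integral class with `V_{𝔭₀} = η(d)`, `d > 0`:
  the unit `u` of (T) preserves the layer and every `int₂ 𝔭`, so `u(η d) = V(twist u h) = η d′` with `d′ ≥ 0`,
  whence `d′ = d` (`CyclotomeRigidity.eq_or_eq_neg_of_apply_eta`: "`ℚ ∩ Ẑ^× = {±1}`") and `u = 1`
  (`CyclotomeRigidity.eq_one_of_apply_eta_self`);
* `CyclotomeComparisonFamily.induced_eq_of_valuation` — the container-level form (`twist 1 = id` instead of `zμ`).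

HONEST FRAMING: (E), (T), (L), (I′), (P′) are typed, not proved (GAP G-w4d057g4-1); nothing here asserts a
disputed claim or takes a side on [IUTchIII] Cor. 3.12; typed ≠ proved.
-/

namespace Literature.IUT.HodgeTheaters

open ProfiniteGrp ProfiniteGrp.ProfiniteCompletion
open Literature.AnabelianGeometry.EtaleTheta Literature.AnabelianGeometry.EtaleTheta.ZHatLevel

universe u w w'

/-- **Ex. 5.1 (v), p. 128 l. 25–49 — `UniqueCyclotomeIsoFamily C` from a `Ẑ^×`-linear valuation on the
container.**  Let `C` be abc-iut-L5-t12's comparison family, `zμ` an action of `Ẑ^× = Aut(Ẑ)` on the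
isomorphisms of cyclotomes with `zμ 1 = id`, `twist` one on the target container, `i₀` one layer [`mod`], and
`V 𝔭 : H₂ → Ẑ` (`𝔭 : 𝔓`) maps on the container [`v̂_𝔭`].  Suppose:
(E) some isomorphism of cyclotomes satisfies the whole such-that clause;
(T) any two isomorphisms differ by a unit `u`, `e′ = zμ u e`, with `induced e′ = twist u ∘ induced e`;
(L) `V 𝔭` is `Ẑ^×`-linear on the layer: `V 𝔭 (twist u h) = u (V 𝔭 h)` for `h ∈ im₂ i₀`;
(I′) a class of the layer lying in `int₂ 𝔭` has `V 𝔭`-value `η d` for an integer `d ≥ 0`;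
(P′) some class of the layer lies in `int₂ 𝔭₀` with `V 𝔭₀`-value `η d`, `d > 0`.
Then exactly one isomorphism of cyclotomes satisfies the such-that clause.
([IUTchI] Ex 5.1 (v) p.128) [claim: Mochizuki2012, status: disputed] -/
theorem UniqueCyclotomeIsoFamily.of_valuation {ι : Type w} {𝔓 : Type w'}
    (C : CyclotomeComparisonFamily ι 𝔓) (i₀ : ι)
    (zμ : MulAut (completion (GrpCat.of (Multiplicative ℤ))) → (C.μ₁ ≃* C.μ₂) → (C.μ₁ ≃* C.μ₂))
    (hzμ_one : ∀ e, zμ 1 e = e)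
    (twist : MulAut (completion (GrpCat.of (Multiplicative ℤ))) → C.H₂ → C.H₂)
    (hex : ∃ e, C.InducesCompatibleIsos e)
    (htors : ∀ e e' : C.μ₁ ≃* C.μ₂, ∃ u : MulAut (completion (GrpCat.of (Multiplicative ℤ))),
      e' = zμ u e ∧ ∀ h, C.induced e' h = twist u (C.induced e h))
    (V : 𝔓 → C.H₂ → completion (GrpCat.of (Multiplicative ℤ)))
    (hlin : ∀ (𝔭 : 𝔓) (u : MulAut (completion (GrpCat.of (Multiplicative ℤ)))),
      ∀ h ∈ C.im₂ i₀, V 𝔭 (twist u h) = u (V 𝔭 h))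
    (hint : ∀ 𝔭 : 𝔓, ∀ h ∈ C.im₂ i₀, h ∈ C.int₂ 𝔭 → ∃ d : ℤ, 0 ≤ d ∧ V 𝔭 h = eta d)
    (hpos : ∃ 𝔭₀ : 𝔓, ∃ h ∈ C.im₂ i₀, h ∈ C.int₂ 𝔭₀ ∧ ∃ d : ℤ, 0 < d ∧ V 𝔭₀ h = eta d) :
    UniqueCyclotomeIsoFamily C := by
  obtain ⟨e₀, he₀⟩ := hex
  refine ⟨⟨e₀, he₀, fun e he => ?_⟩⟩
  obtain ⟨u, hue, hu⟩ := htors e₀ e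
  -- `twist u` preserves the layer and every integral submonoid
  have hmaps : Set.MapsTo (twist u) (C.im₂ i₀) (C.im₂ i₀) := by
    intro h hh
    obtain ⟨h₁, hh₁, rfl⟩ := (he₀.1 i₀).surjOn hh
    rw [← hu h₁]
    exact (he.1 i₀).mapsTo hh₁
  have hmapsInt : ∀ 𝔭 : 𝔓, Set.MapsTo (twist u) (C.int₂ 𝔭) (C.int₂ 𝔭) := by
    intro 𝔭 h hh
    obtain ⟨h₁, hh₁, rfl⟩ := (he₀.2 𝔭).surjOn hh
    rw [← hu h₁]
    exact (he.2 𝔭).mapsTo hh₁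
  -- one positive valuation is carried to a nonnegative one: `u(η d) = η d′`, `d > 0`, `d′ ≥ 0`
  obtain ⟨𝔭₀, h, hh, hhint, d, hd, hVh⟩ := hpos
  obtain ⟨d', hd', hVh'⟩ := hint 𝔭₀ (twist u h) (hmaps hh) (hmapsInt 𝔭₀ hhint)
  have key : u (eta d) = eta d' := by rw [← hVh, ← hlin 𝔭₀ u h hh, hVh']
  -- "`ℚ ∩ Ẑ^× = {±1}`" and the sign: `d′ = d`, hence `u = 1`
  have hd0 : d ≠ 0 := ne_of_gt hd
  have hu1 : u = 1 := by
    rcases CyclotomeRigidity.eq_or_eq_neg_of_apply_eta u hd0 key with h1 | h1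
    · rw [h1] at key
      exact CyclotomeRigidity.eq_one_of_apply_eta_self u hd0 key
    · exact absurd h1 (by omega)
  rw [hue, hu1, hzμ_one]

/-- Container-level form: under (T) (without the `zμ`-bookkeeping, with `twist 1 = id`), (L), (I′), (P′), the
container maps of ANY two isomorphisms of cyclotomes satisfying the such-that clause agree.
([IUTchI] Ex 5.1 (v) p.128) [claim: Mochizuki2012, status: disputed] -/
theorem CyclotomeComparisonFamily.induced_eq_of_valuation {ι : Type w} {𝔓 : Type w'}
    (C : CyclotomeComparisonFamily ι 𝔓) (i₀ : ι)
    (twist : MulAut (completion (GrpCat.of (Multiplicative ℤ))) → C.H₂ → C.H₂)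
    (htwist_one : ∀ h, twist 1 h = h)
    (htors : ∀ e e' : C.μ₁ ≃* C.μ₂, ∃ u : MulAut (completion (GrpCat.of (Multiplicative ℤ))),
      ∀ h, C.induced e' h = twist u (C.induced e h))
    (V : 𝔓 → C.H₂ → completion (GrpCat.of (Multiplicative ℤ)))
    (hlin : ∀ (𝔭 : 𝔓) (u : MulAut (completion (GrpCat.of (Multiplicative ℤ)))),
      ∀ h ∈ C.im₂ i₀, V 𝔭 (twist u h) = u (V 𝔭 h))
    (hint : ∀ 𝔭 : 𝔓, ∀ h ∈ C.im₂ i₀, h ∈ C.int₂ 𝔭 → ∃ d : ℤ, 0 ≤ d ∧ V 𝔭 h = eta d)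
    (hpos : ∃ 𝔭₀ : 𝔓, ∃ h ∈ C.im₂ i₀, h ∈ C.int₂ 𝔭₀ ∧ ∃ d : ℤ, 0 < d ∧ V 𝔭₀ h = eta d)
    {e₀ e : C.μ₁ ≃* C.μ₂} (he₀ : C.InducesCompatibleIsos e₀) (he : C.InducesCompatibleIsos e) :
    ∀ h, C.induced e h = C.induced e₀ h := by
  obtain ⟨u, hu⟩ := htors e₀ e
  have hmaps : Set.MapsTo (twist u) (C.im₂ i₀) (C.im₂ i₀) := by
    intro h hh
    obtain ⟨h₁, hh₁, rfl⟩ := (he₀.1 i₀).surjOn hh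
    rw [← hu h₁]
    exact (he.1 i₀).mapsTo hh₁
  have hmapsInt : ∀ 𝔭 : 𝔓, Set.MapsTo (twist u) (C.int₂ 𝔭) (C.int₂ 𝔭) := by
    intro 𝔭 h hh
    obtain ⟨h₁, hh₁, rfl⟩ := (he₀.2 𝔭).surjOn hh
    rw [← hu h₁]
    exact (he.2 𝔭).mapsTo hh₁
  obtain ⟨𝔭₀, h, hh, hhint, d, hd, hVh⟩ := hpos
  obtain ⟨d', hd', hVh'⟩ := hint 𝔭₀ (twist u h) (hmaps hh) (hmapsInt 𝔭₀ hhint)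
  have key : u (eta d) = eta d' := by rw [← hVh, ← hlin 𝔭₀ u h hh, hVh']
  have hd0 : d ≠ 0 := ne_of_gt hd
  have hu1 : u = 1 := by
    rcases CyclotomeRigidity.eq_or_eq_neg_of_apply_eta u hd0 key with h1 | h1
    · rw [h1] at key
      exact CyclotomeRigidity.eq_one_of_apply_eta_self u hd0 key
    · exact absurd h1 (by omega)
  intro h'
  rw [hu h', hu1, htwist_one]

end Literature.IUT.HodgeTheaters
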